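import Summits.CriticalPhenomena.CardyFormulaZ2.Theorems.CardyMeckeFlipMeckeRigidityToggledIntegrand

/-!
# The one-quad content of the flip identity: pivotal mass balances between crossed and uncrossed configurations

Route `Summits/CriticalPhenomena/CardyFormulaZ2/Theses/CardyMeckeFlip`, crux `MeckeRigidity`
(item stmt-CriticalPhenomena-14826), line `registered`, stub `stub_crossingUniqueness` (helper).

Clause (F) tested on ONE quad `Q` (family `Fin 1`, pattern function "is index `0` crossed") says,
after the bookkeeping of `…CampbellIntegrand` / `…ToggledIntegrand` (both Campbell integrands are in
`L¹(P)`, the pivotal x-sections are Borel):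

  `∫_{⊞_Q} M ε S(φ · 1_{Piv_Q(S)}) P(dS) = ∫_{⊞_Qᶜ} M ε S(φ · 1_{Piv_Q(S)}) P(dS)`

for every `φ ∈ C_c(ℂ)` (`setIntegral_crossedEvent_pivotalMass_eq`; registered `∀`-form
`flipFair_setIntegral_pivotalMass_eq`): the Campbell mass of the `Q`-pivotal points sitting on
configurations where `Q` IS crossed equals the mass sitting on configurations where it is NOT —
the continuum form of Russo's symmetry `P(⊞_Q | x pivotal) = ½` at criticality, i.e. stationarity
of `P(⊞_Q)` under the flip dynamics (its generator applied to `1_{⊞_Q}` has mean zero).  This is the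
identity every coupling / uniqueness argument for the flip dynamics differentiates.
-/

noncomputable section

open MeasureTheory Set Metric Filter Topology
open scoped ENNReal NNReal
open Literature.Probability.Percolation Literature.Probability.Percolation.QuadCrossing

namespace Summit.CriticalPhenomena.CardyFormulaZ2.Theorems.CardyMeckeFlip

variable {D : Set ℂ}

/-- The one-quad pattern function "index `0` is in the pattern", evaluated on the crossing
pattern: the indicator of `⊞_Q`. [folklore] -/
theorem pattern_indicator_one_quad (Q : Quad D) (S : QuadConfig D) :
    ({i : Fin 1 | (fun _ : Fin 1 => Q) i ∈ S} : Set (Fin 1)).indicator (fun _ => (1 : ℝ)) 0 =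
      (QuadConfig.crossedEvent Q).indicator (fun _ => (1 : ℝ)) S := by
  by_cases h : Q ∈ S
  · rw [Set.indicator_of_mem (show (0 : Fin 1) ∈ {i : Fin 1 | (fun _ : Fin 1 => Q) i ∈ S} from h),
      Set.indicator_of_mem (QuadConfig.mem_crossedEvent.2 h)]
  · rw [Set.indicator_of_notMem (show (0 : Fin 1) ∉ {i : Fin 1 | (fun _ : Fin 1 => Q) i ∈ S} from h),
      Set.indicator_of_notMem (fun h' => h (QuadConfig.mem_crossedEvent.1 h'))]

open Classical in
/-- The one-quad pattern function evaluated on the TOGGLED pattern: `1 − 1_{Piv}` on crossed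
configurations, `1_{Piv}` on uncrossed ones. [folklore] -/
theorem pattern_indicator_one_quad_toggled (Q : Quad D) (S : QuadConfig D) (x : ℂ) :
    ({i : Fin 1 | Xor ((fun _ : Fin 1 => Q) i ∈ S) (S.IsPivotalAt x ((fun _ : Fin 1 => Q) i))} :
        Set (Fin 1)).indicator (fun _ => (1 : ℝ)) 0 =
      if Q ∈ S then 1 - {x | S.IsPivotalAt x Q}.indicator (fun _ => (1 : ℝ)) x
      else {x | S.IsPivotalAt x Q}.indicator (fun _ => (1 : ℝ)) x := by
  by_cases hQ : Q ∈ S <;> by_cases hP : S.IsPivotalAt x Q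
  · rw [if_pos hQ, Set.indicator_of_mem (show x ∈ {x | S.IsPivotalAt x Q} from hP),
      Set.indicator_of_notMem (show (0 : Fin 1) ∉ {i : Fin 1 | Xor ((fun _ : Fin 1 => Q) i ∈ S)
        (S.IsPivotalAt x ((fun _ : Fin 1 => Q) i))} by simp [Xor, hQ, hP])]
    ring
  · rw [if_pos hQ, Set.indicator_of_notMem (show x ∉ {x | S.IsPivotalAt x Q} from hP),
      Set.indicator_of_mem (show (0 : Fin 1) ∈ {i : Fin 1 | Xor ((fun _ : Fin 1 => Q) i ∈ S)
        (S.IsPivotalAt x ((fun _ : Fin 1 => Q) i))} by simp [Xor, hQ, hP])]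
    ring
  · rw [if_neg hQ, Set.indicator_of_mem (show x ∈ {x | S.IsPivotalAt x Q} from hP),
      Set.indicator_of_mem (show (0 : Fin 1) ∈ {i : Fin 1 | Xor ((fun _ : Fin 1 => Q) i ∈ S)
        (S.IsPivotalAt x ((fun _ : Fin 1 => Q) i))} by simp [Xor, hQ, hP])]
  · rw [if_neg hQ, Set.indicator_of_notMem (show x ∉ {x | S.IsPivotalAt x Q} from hP),
      Set.indicator_of_notMem (show (0 : Fin 1) ∉ {i : Fin 1 | Xor ((fun _ : Fin 1 => Q) i ∈ S)
        (S.IsPivotalAt x ((fun _ : Fin 1 => Q) i))} by simp [Xor, hQ, hP])]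

/-- **Pivotal mass balances between crossed and uncrossed configurations** (the one-quad content
of (F)): under (ADM) and (F) at cutoff `ε`, for every quad `Q` and every `φ ∈ C_c(ℂ)`,
`∫_{⊞_Q} ∫_{Piv_Q(S)} φ dM ε S dP = ∫_{⊞_Qᶜ} ∫_{Piv_Q(S)} φ dM ε S dP`. [folklore] -/
theorem setIntegral_crossedEvent_pivotalMass_eq {P : Measure (QuadConfig D)}
    {M : ℝ → QuadConfig D → Measure ℂ} (hADM : IsAdmissibleKernel P M) {ε : ℝ} (hε : 0 < ε)
    (hF : IsFlipFairKernel P (M ε)) (Q : Quad D) {φ : ℂ → ℝ} (hφ : Continuous φ)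
    (hφc : HasCompactSupport φ) :
    ∫ S in QuadConfig.crossedEvent Q, ∫ x in {x | S.IsPivotalAt x Q}, φ x ∂(M ε S) ∂P =
      ∫ S in (QuadConfig.crossedEvent Q)ᶜ, ∫ x in {x | S.IsPivotalAt x Q}, φ x ∂(M ε S) ∂P := by
  -- notation-free names for the three functionals
  have hmeasQ := QuadConfig.measurableSet_crossedEvent Q
  obtain ⟨r, hr⟩ := exists_nat_eq_zero_off_closedBall hφc
  obtain ⟨Cφ, hCφ⟩ := hφ.bounded_above_of_compact_support hφc
  have hgood : ∀ᵐ S ∂P, M ε S (closedBall 0 r) < ∞ :=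
    (ae_kernel_closedBall_lt_top hADM hε).mono fun S h => h r
  -- the datum of (F): one quad, pattern function "index 0 crossed"
  have hFε := hF 1 (fun _ => Q) (fun B => B.indicator (fun _ => (1 : ℝ)) 0) φ hφ hφc
  have hLi := integrable_patternIntegrand hADM hε (fun _ : Fin 1 => Q)
    (fun B => B.indicator (fun _ => (1 : ℝ)) 0) hφ hφc
  have hRi := integrable_toggledIntegrand hADM hε hF (fun _ : Fin 1 => Q)
    (fun B => B.indicator (fun _ => (1 : ℝ)) 0) hφ hφc
  have hmi : Integrable (fun S => ∫ x, φ x ∂(M ε S)) P := by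
    have := integrable_patternIntegrand hADM hε (fun _ : Fin 1 => Q) (fun _ => (1 : ℝ)) hφ hφc
    simpa only [mul_one] using this
  -- the left integrand is `1_{⊞_Q} · m`
  have hL : ∀ S, ∫ x, φ x * ({i : Fin 1 | (fun _ : Fin 1 => Q) i ∈ S} : Set (Fin 1)).indicator
      (fun _ => (1 : ℝ)) 0 ∂(M ε S) =
        (QuadConfig.crossedEvent Q).indicator (fun S => ∫ x, φ x ∂(M ε S)) S := by
    intro S
    rw [integral_mul_const, pattern_indicator_one_quad]
    by_cases h : S ∈ QuadConfig.crossedEvent Q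
    · rw [Set.indicator_of_mem h, Set.indicator_of_mem h, mul_one]
    · rw [Set.indicator_of_notMem h, Set.indicator_of_notMem h, mul_zero]
  -- the right integrand is `m − A` on `⊞_Q` and `A` off it (a.s.), `A` the pivotal mass
  have hA_eq : ∀ S, ∫ x in {x | S.IsPivotalAt x Q}, φ x ∂(M ε S) =
      ∫ x, {x | S.IsPivotalAt x Q}.indicator (fun _ => (1 : ℝ)) x * φ x ∂(M ε S) := by
    intro S
    rw [← integral_indicator (measurableSet_isPivotalAt S Q)]
    congr 1
    funext x
    by_cases hx : x ∈ {x | S.IsPivotalAt x Q}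
    · rw [Set.indicator_of_mem hx, Set.indicator_of_mem hx, one_mul]
    · rw [Set.indicator_of_notMem hx, Set.indicator_of_notMem hx, zero_mul]
  have hR : ∀ᵐ S ∂P, ∫ x, φ x * ({i : Fin 1 | Xor ((fun _ : Fin 1 => Q) i ∈ S)
      (S.IsPivotalAt x ((fun _ : Fin 1 => Q) i))} : Set (Fin 1)).indicator (fun _ => (1 : ℝ)) 0 ∂(M ε S) =
        (QuadConfig.crossedEvent Q).indicator
          (fun S => (∫ x, φ x ∂(M ε S)) - ∫ x in {x | S.IsPivotalAt x Q}, φ x ∂(M ε S)) S +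
        (QuadConfig.crossedEvent Q)ᶜ.indicator
          (fun S => ∫ x in {x | S.IsPivotalAt x Q}, φ x ∂(M ε S)) S := by
    filter_upwards [hgood] with S hS
    have hφi : Integrable φ (M ε S) := integrable_of_eq_zero_off hφ hS hr hCφ
    have hind : Integrable (fun x => {x | S.IsPivotalAt x Q}.indicator (fun _ => (1 : ℝ)) x * φ x) (M ε S) := by
      refine hφi.bdd_mul (c := 1) ((measurable_const.indicator (measurableSet_isPivotalAt S Q)).aestronglyMeasurable)
        (Eventually.of_forall fun x => ?_)
      by_cases hx : x ∈ {x | S.IsPivotalAt x Q}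
      · rw [Set.indicator_of_mem hx, norm_one]
      · rw [Set.indicator_of_notMem hx, norm_zero]; exact zero_le_one
    simp_rw [pattern_indicator_one_quad_toggled Q S]
    by_cases hQ : Q ∈ S
    · have hQ' : S ∈ QuadConfig.crossedEvent Q := hQ
      rw [Set.indicator_of_mem hQ', Set.indicator_of_notMem (Set.notMem_compl_iff.2 hQ'), add_zero, hA_eq S]
      simp only [if_pos hQ]
      have e : (fun x => φ x * (1 - {x | S.IsPivotalAt x Q}.indicator (fun _ => (1 : ℝ)) x)) =
          fun x => φ x - {x | S.IsPivotalAt x Q}.indicator (fun _ => (1 : ℝ)) x * φ x := by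
        funext x; ring
      rw [e, integral_sub hφi hind]
    · have hQ' : S ∉ QuadConfig.crossedEvent Q := hQ
      rw [Set.indicator_of_notMem hQ', Set.indicator_of_mem (show S ∈ (QuadConfig.crossedEvent Q)ᶜ from hQ'),
        zero_add, hA_eq S]
      simp only [if_neg hQ]
      congr 1
      funext x
      ring
  -- the pivotal mass functional `A` is integrable: a.s. a measurable combination of `m` and `R`
  have hAi : Integrable (fun S => ∫ x in {x | S.IsPivotalAt x Q}, φ x ∂(M ε S)) P := by
    have hae : (fun S => ∫ x in {x | S.IsPivotalAt x Q}, φ x ∂(M ε S)) =ᵐ[P] fun S =>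
        (QuadConfig.crossedEvent Q).indicator (fun S => (∫ x, φ x ∂(M ε S)) -
          ∫ x, φ x * ({i : Fin 1 | Xor ((fun _ : Fin 1 => Q) i ∈ S)
            (S.IsPivotalAt x ((fun _ : Fin 1 => Q) i))} : Set (Fin 1)).indicator (fun _ => (1 : ℝ)) 0 ∂(M ε S)) S +
        (QuadConfig.crossedEvent Q)ᶜ.indicator (fun S =>
          ∫ x, φ x * ({i : Fin 1 | Xor ((fun _ : Fin 1 => Q) i ∈ S)
            (S.IsPivotalAt x ((fun _ : Fin 1 => Q) i))} : Set (Fin 1)).indicator (fun _ => (1 : ℝ)) 0 ∂(M ε S)) S := by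
      filter_upwards [hR] with S hS
      by_cases hQ : S ∈ QuadConfig.crossedEvent Q
      · rw [Set.indicator_of_mem hQ, Set.indicator_of_notMem (Set.notMem_compl_iff.2 hQ), add_zero, hS,
          Set.indicator_of_mem hQ, Set.indicator_of_notMem (Set.notMem_compl_iff.2 hQ), add_zero]
        ring
      · rw [Set.indicator_of_notMem hQ, Set.indicator_of_mem (show S ∈ (QuadConfig.crossedEvent Q)ᶜ from hQ),
          zero_add, hS, Set.indicator_of_notMem hQ,
          Set.indicator_of_mem (show S ∈ (QuadConfig.crossedEvent Q)ᶜ from hQ), zero_add]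
    refine Integrable.congr ?_ hae.symm
    have hmRi : Integrable (fun S => (∫ x, φ x ∂(M ε S)) -
        ∫ x, φ x * ({i : Fin 1 | Xor ((fun _ : Fin 1 => Q) i ∈ S)
          (S.IsPivotalAt x ((fun _ : Fin 1 => Q) i))} : Set (Fin 1)).indicator (fun _ => (1 : ℝ)) 0 ∂(M ε S)) P :=
      hmi.sub hRi
    exact (hmRi.indicator hmeasQ).add (hRi.indicator hmeasQ.compl)
  have hmAi : Integrable (fun S => (∫ x, φ x ∂(M ε S)) - ∫ x in {x | S.IsPivotalAt x Q}, φ x ∂(M ε S)) P :=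
    hmi.sub hAi
  -- (F) becomes `∫_{⊞} m = ∫_{⊞} (m − A) + ∫_{⊞ᶜ} A`
  simp_rw [hL] at hFε
  rw [integral_congr_ae hR, integral_indicator hmeasQ,
    integral_add (hmAi.indicator hmeasQ) (hAi.indicator hmeasQ.compl),
    integral_indicator hmeasQ, integral_indicator hmeasQ.compl] at hFε
  rw [integral_sub hmi.integrableOn hAi.integrableOn] at hFε
  linarith

/-- **Registered form** (sub-goal `flipFair_setIntegral_pivotalMass_eq` of item
stmt-CriticalPhenomena-14826): under (ADM) and (F) at cutoff `ε > 0`, the Campbell mass of the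
`Q`-pivotal points on crossed configurations equals that on uncrossed configurations, for every quad
`Q` and every continuous compactly supported test function. [folklore] -/
theorem flipFair_setIntegral_pivotalMass_eq : ∀ (D : Set ℂ) (P : Measure (QuadConfig D)) (M : ℝ → QuadConfig D → Measure ℂ), IsAdmissibleKernel P M → ∀ ε : ℝ, 0 < ε → IsFlipFairKernel P (M ε) → ∀ (Q : Quad D) (φ : ℂ → ℝ), Continuous φ → HasCompactSupport φ → ∫ S in QuadConfig.crossedEvent Q, ∫ x in {x | S.IsPivotalAt x Q}, φ x ∂(M ε S) ∂P = ∫ S in (QuadConfig.crossedEvent Q)ᶜ, ∫ x in {x | S.IsPivotalAt x Q}, φ x ∂(M ε S) ∂P := by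
  intro D P M hADM ε hε hF Q φ hφ hφc
  exact setIntegral_crossedEvent_pivotalMass_eq hADM hε hF Q hφ hφc

end Summit.CriticalPhenomena.CardyFormulaZ2.Theorems.CardyMeckeFlip

end
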